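import Literature.IUT.HodgeTheaters.CoveringsErrata
import Literature.AnabelianGeometry.SemiGraphs.PSCCuspidalCriterionProofs
import HarnessLib

/-!
# [IUTchI] Remark 1.2.3 (vi): the cuspidality reduction, DISCHARGED for every profinite origin

Mochizuki, *Inter-universal Teichmüller Theory I*, kurims manuscript (May 2020), Remark 1.2.3 (vi),
p. 43 [cite: Mochizuki2012, IUTchI Rmk 1.2.3 (vi) p.43] (D-0012 claim key; the series' status is
DISPUTED — the content here is combinatorial anabelian group theory of [CombGC] §1, no side taken):
the replacement text of the second paragraph of the proof of [CombGC] Theorem 1.6 (i), "the fact that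
`α` is group-theoretically cuspidal follows formally from the characterization of cuspidal edge-like
subgroups given in Remark 1.4.3 [as amended, Rmk. 1.2.3 (iv)] and the characterization of cuspidally
totally ramified cyclic finite étale coverings given in Remark 1.4.2 [as amended, Rmk. 1.2.3 (iii)]".

`CoveringsErrata.lean` (abc-iut-L5-t6) typed this sentence as the named statement
`Rmk123.GroupTheoreticCuspidalityReduction Ω` — for an origin predicate `Ω : PSCOrigin` ("of pro-`Σ`
PSC-type", [CombGC] Def. 1.1 (i), a BLACKBOX parameter of abc-iut-L3-t4's interface), all `G`, `H` of
`Ω`-PSC-type with `Σ = {l}`, the two amended characterizations for `G` and for `H`, and every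
numerically cuspidal `α : Π_G ≅ Π_H`.  Meanwhile the printed "follows formally" has been KERNEL-CHECKED
over the interface by abc-iut-w4-d052 (`PSCDatum.isGroupTheoreticallyCuspidal_of_isNumericallyCuspidal`,
`PSCCuspidalCriterionProofs.lean`, cone row `CombGC:Thm1.6` (i) / sub-DAG row T16-L03) for all data
with PROFINITE (compact) `Π_G`, `Π_H` — compactness being used once, for "characteristic open ⟹
finite index".  The interface `PSCDatum` does not record that `Π_G` is profinite, and the blackbox
`Ω.IsOfPSCType` implies nothing; so the named statement is discharged here for EVERY origin predicate
whose data of PSC-type have compact `Π` (`Rmk123.groupTheoreticCuspidalityReduction_of_compactOrigin`)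
— which the geometric origin of Def. 1.1 (i) satisfies by construction ("the pro-`Σ` completion … of
the semi-graph of anabelioids", a profinite group).  The two hypotheses
`CyclicCuspidallyTotallyRamifiedIff` of the typed statement (Rmk. 1.2.3 (iii)) are not needed by the
kernel route, which proves the relative cusp-count criterion for every datum
(`isCuspidallyTotallyRamified_iff_cuspCount_lt`).  Proof-only file (theorems only); typed ≠ proved for
a non-profinite `Ω`, for which the statement is not claimed in print.
-/

namespace Literature.IUT.HodgeTheaters.Rmk123

open Literature.AnabelianGeometry.SemiGraphs

universe u

/-- **[IUTchI] Remark 1.2.3 (vi) holds for every profinite origin predicate**: if every datum of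
`Ω`-PSC-type has compact `Π` (as the pro-`Σ` completions of [CombGC] Def. 1.1 (i) do), then
`GroupTheoreticCuspidalityReduction Ω` — numerically cuspidal ⟹ group-theoretically cuspidal at
`Σ = {l}`, granted the amended characterizations Rmk. 1.2.3 (iii)/(iv) for `G` and `H` — holds, by
abc-iut-w4-d052's kernel `PSCDatum.isGroupTheoreticallyCuspidal_of_isNumericallyCuspidal` (BY NAME).
[cite: Mochizuki2012, IUTchI Rmk 1.2.3 (vi) p.43] -/
theorem groupTheoreticCuspidalityReduction_of_compactOrigin (Ω : PSCOrigin.{u})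
    (hΩ : ∀ ⦃Q : Type u⦄ [Group Q] [TopologicalSpace Q] (G : PSCDatum Q),
      Ω.IsOfPSCType G → CompactSpace Q) :
    GroupTheoreticCuspidalityReduction Ω := by
  intro Q _ _ _ Q' _ _ _ G H α l hG hH hSG hSH hcG hcH _ _ hnum
  haveI : CompactSpace Q := hΩ G hG
  haveI : CompactSpace Q' := hΩ H hH
  exact PSCDatum.isGroupTheoreticallyCuspidal_of_isNumericallyCuspidal hSG hSH hcG hcH hnum

end Literature.IUT.HodgeTheaters.Rmk123
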